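import Literature.AlgebraicGeometry.Resolution.HenselianRationalGeneratorDense
import Literature.AlgebraicGeometry.Resolution.RelAlgClosedImmediate
import Literature.AlgebraicGeometry.Resolution.TameDescentTrace
import Literature.AlgebraicGeometry.Resolution.ValuativeDatumFiniteLevel
import Literature.AlgebraicGeometry.Resolution.HenselizationDirectedUnion
import Literature.AlgebraicGeometry.Resolution.GeneralizedStabilityRankOneVT
import Literature.AlgebraicGeometry.Resolution.ResidueTranscendentalExtensions
import Literature.AlgebraicGeometry.Resolution.HenselizedFunctionFieldsImmediate
import Literature.AlgebraicGeometry.Resolution.KnafKuhlmann2009Thm11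
import Literature.AlgebraicGeometry.Resolution.ValuedFunctionFieldsLemmas
import Mathlib.FieldTheory.AlgebraicClosure
import HarnessLib

/-!
# The valuative input (J1) of Thm. 3.3.1 in characteristic `p`, from henselian rationality over a perfect henselian split base

Topic: `Literature/AlgebraicGeometry/Resolution` (valued function fields). M. Temkin, *Inseparable
local uniformization*, J. Algebra 373 (2013) = arXiv:0804.1554v3, Thm. 3.3.1 (tree: the named
fact `Temkin2013RelativeCurveSmoothFibre`, reduced by `Temkin2013RelativeCurveSmoothFibre.of_inputs`,
`RelativeCurveSmoothFibreAssembly.lean`, to the valuative input (J1) and the algebraization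
(J2)). This file PROVES (J1) in characteristic `p > 0` from ONE valuation-theoretic statement,
taken as an explicit hypothesis `(HR)` (an inline proposition, not a named fact):

> **(HR) Henselian rationality over a perfect henselian ground field of rank one, split case**
> (Temkin 2013, Thm. 3.2.3, Step 1 "The Theorem holds when `K` is `k`-split", in the henselian
> rendering of `HenselianRationalityPerfectSplit.lean`): for `C ≤ F ≤ Ω` with `C` perfect,
> henselian, of rank one, `F|C` finitely and separably generated of transcendence degree `1`,
> `(F|C, V)` immediate and `C` algebraically closed in `F^h`: `F ≤ C(x)^h` for some `x ∈ F`
> transcendental over `C`.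

(The tree's `henselianRational_of_perfect_of_forall_isAlgebraic_mem` is (HR) under the extra
hypothesis "`C` has no proper tame extension"; removing it is the pull-down of henselian
rationality through tame extensions, Kuhlmann–Vlahu 2014, §14 = Temkin's Step 1, in progress in
the companion files `TameDescentLemmas.lean`, `RelAlgClosedRootLayers.lean`.)

The proof of **(HR) ⇒ (J1)** follows Temkin's proof of Thm. 3.2.6, Step 2 and Thm. 3.2.3,
Step 2 (pp. 42–43 of arXiv:0804.1554v3), read in henselizations:

1. *Perfect base change* (Thm. 3.2.6, Step 2: "`k'' := \overline{k_p}` is the completed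
   perfection of `k` … `Y = C \widehat{⊗}_k k''`"): `P = k^{1/p^∞} ∩ Ω` (`perfectHull k`),
   `K' = K₁·P`.
2. *Relative algebraic closure* (Thm. 3.2.3, Step 2: "If `L ⊂ K` is the completion of the field
   `K ∩ k^a` … then `L` is algebraically closed in `K` by Ax–Sen theorem … `K` is `L`-split by
   Corollary 3.1.10"): `E = K'^h`, `C = E ∩ k̃` — perfect, henselian, of rank one, algebraically
   closed in `E = (K'·C)^h`, and `E|C` IMMEDIATE (`isImmediateOver_of_forall_isAlgebraic_mem`,
   `RelAlgClosedImmediate.lean`; in the henselian rendering no Ax–Sen–Tate theorem is needed: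
   type `1` and type `4` are treated uniformly).
3. (HR) for `F = K₁·C` over `C`: `F ≤ C(x)^h`, `x ∈ F`.
4. *The generator in `K' = K₁·P`* (Thm. 3.2.6, Step 2: "`𝒜 ⊗_k k_p` is dense in
   `𝒜 \widehat{⊗}_k k''` … Hence we can move `T` so that `T ∈ 𝒜 ⊗_k k_p`"):
   `kuhlmannVlahu_thm111_of_perfect_of_dense` (`HenselianRationalGeneratorDense.lean`,
   Kuhlmann–Vlahu 2014, Thm. 11.1 with its `γ`-clause), `K'` being dense in `F ≤ K'^h`; then
   `t = x` or `x⁻¹` lies in `O_V`.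
5. *Finite level* (Thm. 3.2.6, Step 2: "then `T ∈ 𝒜 ⊗_k k'` already for a `k`-finite subfield
   `k' ⊂ k_p`"; Thm. 3.2.3, Step 2: "`K` coincides with `\overline{l(T)}` already for a
   `k`-finite subfield `l ↪ L`"): `exists_finite_level_valuative_datum`
   (`ValuativeDatumFiniteLevel.lean`) and `exists_finset_forall_mem_closure_levels`
   (`HenselizationDirectedUnion.lean`: the henselization of a directed union).

* `forall_exists_pow_eq_of_perfectField`, `isSeparable_of_isAlgebraic_of_perfectField` —
  bookkeeping — PROVED (`perfectField_of_forall_exists_pow_eq` is `TameDescentTrace.lean`).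
* `valuativeInput_charP_of_henselianRational` — **(HR) ⇒ (J1) in characteristic `p`** — PROVED.

No definitions, no named facts.

## Sources

* M. Temkin, arXiv:0804.1554v3: Thm. 3.2.3 and its proof (Steps 1–2), Thm. 3.2.6 and its proof
  (Step 2), Thm. 3.3.1 (proof, Step 2) (pp. 41–45). [Temkin2013]
* F.-V. Kuhlmann, I. Vlahu, Math. Z. 276 (2014) = arXiv:1304.0200, Thm. 11.1, §14.
  [KuhlmannVlahu2014]
-/

noncomputable section

open IsLocalRing

namespace Literature.AlgebraicGeometry.Resolution

universe u

variable {Ω : Type u} [Field Ω]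

/-! ### Bookkeeping: perfect subfields -/

/-- In a perfect subfield every element is a `p`-th power (`p` the characteristic). [folklore] -/
theorem forall_exists_pow_eq_of_perfectField (p : ℕ) [Fact p.Prime] [CharP Ω p] (C : Subfield Ω)
    [PerfectField C] : ∀ y ∈ C, ∃ b ∈ C, b ^ p = y := by
  haveI : CharP C p := ((algebraMap C Ω).charP_iff_charP p).mpr inferInstance
  haveI : ExpChar C p := ExpChar.prime Fact.out
  intro y hy
  obtain ⟨b, hb⟩ := (PerfectField.toPerfectRing (K := C) p).bijective_frobenius.2 ⟨y, hy⟩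
  exact ⟨b, b.2, by simpa [frobenius_def] using congrArg Subtype.val hb⟩

/-- Elements algebraic over a perfect subfield are separable over it. [folklore] -/
theorem isSeparable_of_isAlgebraic_of_perfectField {C : Subfield Ω} [PerfectField C] {x : Ω}
    (hx : IsAlgebraic C x) : IsSeparable C x :=
  PerfectField.separable_of_irreducible (minpoly.irreducible hx.isIntegral)

/-! ### (HR) ⇒ (J1) in characteristic `p` -/

set_option maxHeartbeats 1600000 in
/-- **(J1) in characteristic `p`, from henselian rationality over a perfect henselian split base
of rank one.** Let `(Ω, V)` be algebraically closed of characteristic `p > 0` with residue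
characteristic `p`, `k ≤ K₁ ≤ Ω` with `k` of rank one, `K₁|k` finitely generated of
transcendence degree one, `|K₁^×|/|k^×|` torsion and `K̃₁|k̃` algebraic. Assume (HR) (module
docstring). Then there are finite sets `S` (purely inseparable over `k`) and `Y` (separable over
`k(S)`, inside `(K₁·k(S))^h`) and `t ∈ K₁·k(S) ∩ O_V` transcendental over `k` with
`K₁ ≤ k(S, Y)(t)^h`. (Separable generation of `K₁|k` is not needed for this implication.)
[cite: Temkin2013, Thm. 3.2.6 (proof, Step 2), Thm. 3.2.3 (proof, Step 2), Thm. 3.3.1 (proof, Step 2)]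
[cite: KuhlmannVlahu2014, Thm. 11.1] -/
theorem valuativeInput_charP_of_henselianRational [IsAlgClosed Ω] (V : ValuationSubring Ω)
    (p : ℕ) [Fact p.Prime] [CharP Ω p] [CharP (ResidueField V) p]
    (HR : ∀ C F : Subfield Ω, IsHenselianField C (V.comap (algebraMap C Ω)) →
      (∀ y ∈ C, ∃ b ∈ C, b ^ p = y) → IsRankOne V C → C ≤ F → FGOver C F →
      SeparablyGeneratedOver C F →
      (∃ t ∈ F, Transcendental C t ∧
        ∀ z ∈ F, IsAlgebraic (IntermediateField.adjoin C ({t} : Set Ω)) z) →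
      IsImmediateOver V C F → (∀ a ∈ henselization V F, IsAlgebraic C a → a ∈ C) →
      ∃ x ∈ F, Transcendental C x ∧ F ≤ henselization V (Subfield.closure ((C : Set Ω) ∪ {x})))
    (k K₁ : Subfield Ω) (hkK₁ : k ≤ K₁) (hr1 : IsRankOneValued V k) (hfg : FGOver k K₁)
    (h1 : ∃ t ∈ K₁, Transcendental k t ∧
      ∀ z ∈ K₁, IsAlgebraic (IntermediateField.adjoin k ({t} : Set Ω)) z)
    (hvt : IsValueTorsionOver V k K₁) (hra : IsResiduallyAlgebraicOver V k K₁) :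
    ∃ (S Y : Finset Ω) (t : Ω), (∀ s ∈ S, ∃ n : ℕ, s ^ (ringExpChar Ω) ^ n ∈ k) ∧
      (∀ y ∈ Y, IsSeparable (Subfield.closure ((k : Set Ω) ∪ ↑S)) y) ∧
      t ∈ K₁ ⊔ Subfield.closure ((k : Set Ω) ∪ ↑S) ∧ t ∈ V ∧ Transcendental k t ∧
      (↑Y : Set Ω) ⊆ henselization V (K₁ ⊔ Subfield.closure ((k : Set Ω) ∪ ↑S)) ∧
      K₁ ≤ henselization V (Subfield.closure ((k : Set Ω) ∪ ↑S ∪ ↑Y ∪ {t})) := by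
  classical
  have hp : p.Prime := Fact.out
  have hH := Kuhlmann2010HenselizationIsHenselian_holds.{u}
  obtain ⟨t₀, ht₀K₁, ht₀tr, halg₀⟩ := h1
  ------------------------------------------------------------------
  -- ### Step 1: the perfect hull `P` of `k`, `K' = K₁·P`
  ------------------------------------------------------------------
  set P : Subfield Ω := perfectHull k with hPdef
  have hkP : k ≤ P := le_perfectHull k
  have hPalg : ∀ s ∈ P, IsAlgebraic k s := fun s hs => isAlgebraic_of_mem_perfectHull k hs
  haveI : PerfectField P := perfectField_perfectHull k
  have hPperf : ∀ y ∈ P, ∃ b ∈ P, b ^ p = y := forall_exists_pow_eq_of_perfectField p P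
  set K' : Subfield Ω := K₁ ⊔ P with hK'def
  have hK₁K' : K₁ ≤ K' := le_sup_left
  have hPK' : P ≤ K' := le_sup_right
  have hkK' : k ≤ K' := hkP.trans hPK'
  -- `K'` is algebraic over `K₁`
  have hK'alg : ∀ w ∈ K', IsAlgebraic K₁ w := by
    intro w hw
    have hw' : w ∈ Subfield.closure ((K₁ : Set Ω) ∪ (P : Set Ω)) := by
      rwa [Subfield.closure_union, Subfield.closure_eq, Subfield.closure_eq]
    exact isAlgebraic_of_mem_closure (fun s hs => isAlgebraic_of_subfield_le hkK₁ (hPalg s hs)) hw'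
  ------------------------------------------------------------------
  -- ### Step 2: `E = K'^h`, the constants `C = E ∩ k̃`, `F = K₁·C`
  ------------------------------------------------------------------
  set E : Subfield Ω := henselization V K' with hEdef
  set C : Subfield Ω := E ⊓ (algebraicClosure k Ω).toSubfield with hCdef
  have hK'E : K' ≤ E := le_henselization V K'
  have hE : IsHenselianField E (V.comap (algebraMap E Ω)) := hH Ω V K'
  have himmK'E : IsImmediateOver V K' E := Kuhlmann2010HenselizationImmediate_holds Ω V K'
  have hCE : C ≤ E := inf_le_left
  have hCalg : ∀ w ∈ C, IsAlgebraic k w := fun w hw =>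
    mem_algebraicClosure_iff.mp (Subfield.mem_inf.mp hw).2
  have hmemC : ∀ {w : Ω}, w ∈ E → IsAlgebraic k w → w ∈ C := fun hwE hw =>
    Subfield.mem_inf.mpr ⟨hwE, mem_algebraicClosure_iff.mpr hw⟩
  have hPC : P ≤ C := fun s hs => hmemC (hK'E (hPK' hs)) (hPalg s hs)
  have hkC : k ≤ C := hkP.trans hPC
  have hCrelE : ∀ a ∈ E, IsAlgebraic C a → a ∈ C := fun a haE ha =>
    hmemC haE (isAlgebraic_trans_subfield hkC hCalg ha)
  set F : Subfield Ω := K₁ ⊔ C with hFdef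
  have hK₁F : K₁ ≤ F := le_sup_left
  have hCF : C ≤ F := le_sup_right
  have hK'F : K' ≤ F := sup_le hK₁F (hPC.trans hCF)
  have hFE : F ≤ E := sup_le (hK₁K'.trans hK'E) hCE
  have hFhE : henselization V F ≤ E := henselization_le_of_isHenselianField V F hFE hE
  have hrel : ∀ a ∈ henselization V F, IsAlgebraic C a → a ∈ C := fun a ha halg =>
    hCrelE a (hFhE ha) halg
  -- `C` is henselian
  have hChens : IsHenselianField C (V.comap (algebraMap C Ω)) := by
    have hle : henselization V C ≤ C := by
      intro w hw
      refine hCrelE w (henselization_le_of_isHenselianField V C hCE hE hw) ?_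
      exact (isSeparable_of_mem_henselization V C hw).isIntegral.isAlgebraic
    exact IsHenselianField.of_subfield_algebraic V hle
      (fun y hy => isAlgebraic_algebraMap (⟨y, le_henselization V C hy⟩ : henselization V C))
      (hH Ω V C)
  -- `C` is perfect
  have hCperf : ∀ y ∈ C, ∃ b ∈ C, b ^ p = y := by
    intro y hy
    obtain ⟨b, hb⟩ := IsAlgClosed.exists_pow_nat_eq y hp.pos
    have hyP : IsAlgebraic P y := isAlgebraic_of_subfield_le hkP (hCalg y hy)
    have hbalgP : IsAlgebraic P b := IsAlgebraic.of_pow hp.pos (hb ▸ hyP)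
    -- `b` is separable over `P`, hence over `P(y)`, and `b^p = y ∈ P(y)`: so `b ∈ P(y) ≤ E`
    have hsepb : IsSeparable (Subfield.closure ((P : Set Ω) ∪ {y})) b :=
      isSeparable_of_subfield_le (fun s hs => Subfield.subset_closure (Or.inl hs))
        (isSeparable_of_isAlgebraic_of_perfectField hbalgP)
    haveI : ExpChar Ω p := ExpChar.prime hp
    have hq : ringExpChar Ω = p := ringExpChar.eq Ω p
    have hbPy : b ∈ Subfield.closure ((P : Set Ω) ∪ {y}) := by
      refine mem_of_isSeparable_of_pow_ringExpChar_pow_mem _ hsepb (n := 1) ?_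
      rw [hq, pow_one, hb]
      exact Subfield.subset_closure (Or.inr rfl)
    have hbE : b ∈ E :=
      (Subfield.closure_le.mpr (Set.union_subset (hPK'.trans hK'E)
        (Set.singleton_subset_iff.mpr (hCE hy)))) hbPy
    refine ⟨b, hmemC hbE ?_, hb⟩
    exact IsAlgebraic.of_pow hp.pos (hb ▸ hCalg y hy)
  haveI : PerfectField C := perfectField_of_forall_exists_pow_eq p hCperf
  -- `C` has rank one
  have hCr1 : IsRankOneValued V C := IsRankOneValued.of_algebraic V hkC hr1 hCalg
  have hCr : IsRankOne V C := isRankOne_of_isRankOneValued V hCr1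
  -- `F|C` is finitely generated, separably generated, of transcendence degree one
  have hfgF : FGOver C F := by
    have := hfg.sup_right hkC
    rwa [← hFdef] at this
  have hsgF : SeparablyGeneratedOver C F := separablyGeneratedOver_of_perfectField hfgF
  have ht₀C : Transcendental C t₀ := fun h => ht₀tr (isAlgebraic_trans_subfield hkC hCalg h)
  have halgF : ∀ z ∈ F, IsAlgebraic (IntermediateField.adjoin C ({t₀} : Set Ω)) z := by
    intro z hz
    rw [← isAlgebraic_closure_iff]
    have hz' : z ∈ Subfield.closure
        ((Subfield.closure ((C : Set Ω) ∪ {t₀}) : Set Ω) ∪ ((K₁ : Set Ω) ∪ (C : Set Ω))) := by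
      have hle : F ≤ Subfield.closure
          ((Subfield.closure ((C : Set Ω) ∪ {t₀}) : Set Ω) ∪ ((K₁ : Set Ω) ∪ (C : Set Ω))) := by
        rw [hFdef]
        exact sup_le (fun w hw => Subfield.subset_closure (Or.inr (Or.inl hw)))
          (fun w hw => Subfield.subset_closure (Or.inr (Or.inr hw)))
      exact hle hz
    refine isAlgebraic_of_mem_closure (fun w hw => ?_) hz'
    rcases hw with hwK₁ | hwC
    · have h1 : IsAlgebraic (Subfield.closure ((k : Set Ω) ∪ {t₀})) w :=
        (isAlgebraic_closure_iff k {t₀} w).mpr (halg₀ w hwK₁)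
      exact isAlgebraic_of_subfield_le
        (Subfield.closure_mono (Set.union_subset_union_left _ hkC)) h1
    · exact isAlgebraic_algebraMap
        (⟨w, Subfield.subset_closure (Or.inl hwC)⟩ : Subfield.closure ((C : Set Ω) ∪ {t₀}))
  have h1F : ∃ t ∈ F, Transcendental C t ∧
      ∀ z ∈ F, IsAlgebraic (IntermediateField.adjoin C ({t} : Set Ω)) z :=
    ⟨t₀, hK₁F ht₀K₁, ht₀C, halgF⟩
  -- `F|C` is immediate (`E|C` is: Temkin, Thm. 3.2.3, Step 2)
  have hvtK' : IsValueTorsionOver V k K' :=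
    hvt.trans (isValueTorsionOver_of_isAlgebraic V hK'alg)
  have hraK' : IsResiduallyAlgebraicOver V k K' :=
    hra.trans hkK₁ (isResiduallyAlgebraicOver_of_isAlgebraic V hK'alg)
  have himmE : IsImmediateOver V C E := by
    refine isImmediateOver_of_forall_isAlgebraic_mem V p hCE hCperf hE hCrelE ?_ ?_
    · -- torsion of `vE` over `vC`: `vE = vK'` and `vK'/vk` is torsion
      intro a haE ha0
      obtain ⟨b, hbK', hab⟩ := himmK'E.1 a haE ha0
      have hb0 : b ≠ 0 := by
        rintro rfl
        rw [map_zero, map_eq_zero] at hab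
        exact ha0 hab
      obtain ⟨n, hn0, c, hck, hbc⟩ := hvtK' b hbK' hb0
      refine ⟨n, hn0, c, hkC hck, ?_⟩
      rw [map_pow, hab, ← map_pow, hbc]
    · -- residues of `E` are residues of `K'`, algebraic over `kv ≤ Cv`
      intro r hrE hrV
      have h1 : residue V ⟨r, hrV⟩ ∈ resField V K' :=
        himmK'E.2 (residue_mem_resField V ⟨r, hrV⟩ hrE)
      exact isAlgebraic_of_subfield_le (resField_mono V hkC) (hraK' _ h1)
  have himmF : IsImmediateOver V C F := himmE.mono_right hFE
  ------------------------------------------------------------------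
  -- ### Step 3: (HR) over `C`
  ------------------------------------------------------------------
  obtain ⟨x, hxF, hxt, hFx⟩ := HR C F hChens hCperf hCr hCF hfgF hsgF h1F himmF hrel
  ------------------------------------------------------------------
  -- ### Step 4: the generator in `K' = K₁·P` (KV 2014, Thm. 11.1) and in `O_V`
  ------------------------------------------------------------------
  -- small elements of `k ≤ C ∩ K'`
  have hsmall : ∀ e ∈ C, e ≠ 0 → ∃ d ∈ C, d ∈ K' ∧ d ≠ 0 ∧ V.valuation d < V.valuation e := by
    intro e heC he0
    obtain ⟨a, hak, ha1⟩ := hr1.1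
    have ha0 : a ≠ 0 := fun h => by rw [h, map_zero] at ha1; exact not_lt_zero ha1
    obtain ⟨n, hn⟩ := hCr1.2 a (hkC hak) e⁻¹ (inv_mem heC) ha1
    refine ⟨(a ^ (n + 1))⁻¹, inv_mem (pow_mem (hkC hak) _), inv_mem (pow_mem (hkK' hak) _),
      inv_ne_zero (pow_ne_zero _ ha0), ?_⟩
    have hve : 0 < V.valuation e := (Valuation.pos_iff _).mpr he0
    have hva : 0 < V.valuation a := (Valuation.pos_iff _).mpr ha0
    rw [map_inv₀, map_pow]
    rw [map_inv₀] at hn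
    -- `v(e)⁻¹ ≤ v(a)^n < v(a)^(n+1)`, so `(v(a)^(n+1))⁻¹ < v(e)`
    have hlt : (V.valuation e)⁻¹ < V.valuation a ^ (n + 1) :=
      lt_of_le_of_lt hn (by rw [pow_succ]; exact lt_mul_of_one_lt_right (pow_pos hva n) ha1)
    exact inv_lt_of_inv_lt₀ hve hlt
  -- a separating element of `F|C` inside `K'`
  have hsepD : ∃ z ∈ K', Transcendental C z ∧
      ∀ w ∈ F, IsSeparable (Subfield.closure ((C : Set Ω) ∪ {z})) w := by
    have hfgK' : FGOver P K' := by
      have := hfg.sup_right hkP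
      rwa [← hK'def] at this
    have hsgK' : SeparablyGeneratedOver P K' := separablyGeneratedOver_of_perfectField hfgK'
    have ht₀P : Transcendental P t₀ := fun h => ht₀tr (isAlgebraic_trans_subfield hkP hPalg h)
    have halgK' : ∀ z ∈ K', IsAlgebraic (IntermediateField.adjoin P ({t₀} : Set Ω)) z := by
      intro z hz
      have halgC := halgF z (hK'F hz)
      -- algebraic over `C(t₀)`, and `C(t₀)` is algebraic over `P(t₀)`
      rw [← isAlgebraic_closure_iff] at halgC ⊢
      refine isAlgebraic_trans_subfield (Subfield.closure_mono (Set.union_subset_union_left _ hPC))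
        (fun w hw => ?_) halgC
      refine isAlgebraic_of_mem_closure (K := Subfield.closure ((P : Set Ω) ∪ {t₀}))
        (s := (C : Set Ω)) (fun c hc => ?_) ?_
      · exact isAlgebraic_of_subfield_le (fun s hs => Subfield.subset_closure (Or.inl hs))
          (isAlgebraic_of_subfield_le hkP (hCalg c hc))
      · refine (Subfield.closure_mono ?_) hw
        rintro u (hu | hu)
        · exact Or.inr hu
        · exact Or.inl (Subfield.subset_closure (Or.inr hu))
    obtain ⟨z, hzK', hzP, hsepz⟩ :=
      exists_separating_of_separablyGeneratedOver hsgK' ⟨t₀, hK₁K' ht₀K₁, ht₀P, halgK'⟩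
    refine ⟨z, hzK', fun h => hzP ?_, fun w hw => ?_⟩
    · exact isAlgebraic_of_subfield_le hkP (isAlgebraic_trans_subfield hkC hCalg h)
    · -- `F = K₁·C` is generated over `C(z)` by separable elements
      have hsepK₁ : ∀ u ∈ (K₁ : Set Ω), IsSeparable (Subfield.closure ((C : Set Ω) ∪ {z})) u :=
        fun u hu => isSeparable_of_subfield_le
          (Subfield.closure_mono (Set.union_subset_union_left _ hPC)) (hsepz u (hK₁K' hu))
      have hw' : w ∈ Subfield.closure
          ((Subfield.closure ((C : Set Ω) ∪ {z}) : Set Ω) ∪ (K₁ : Set Ω)) := by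
        have hle : F ≤ Subfield.closure
            ((Subfield.closure ((C : Set Ω) ∪ {z}) : Set Ω) ∪ (K₁ : Set Ω)) := by
          rw [hFdef]
          exact sup_le (fun u hu => Subfield.subset_closure (Or.inr hu))
            (fun u hu => Subfield.subset_closure (Or.inl (Subfield.subset_closure (Or.inl hu))))
        exact hle hw
      exact isSeparable_of_mem_closure hsepK₁ hw'
  obtain ⟨y, hyK', hyt, hFy⟩ :=
    kuhlmannVlahu_thm111_of_perfect_of_dense V p C F K' x hChens hCperf hCr hCF hfgF himmF hrel
      hK'F (hFE.trans le_rfl) hsmall hsepD (le_henselization V F hxF) hxt hFx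
  -- the generator in `O_V`: `y` or `y⁻¹`
  have hy0 : y ≠ 0 := fun h0 => hyt (h0 ▸ isAlgebraic_zero)
  obtain ⟨t, htK', htV, htC, hclos⟩ : ∃ t : Ω, t ∈ K' ∧ t ∈ V ∧ Transcendental C t ∧
      Subfield.closure ((C : Set Ω) ∪ {y}) ≤ Subfield.closure ((C : Set Ω) ∪ {t}) := by
    rcases V.mem_or_inv_mem y with h | h
    · exact ⟨y, hyK', h, hyt, le_rfl⟩
    · refine ⟨y⁻¹, inv_mem hyK', h, fun halg' => hyt ?_, ?_⟩
      · have := halg'.inv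
        rwa [inv_inv] at this
      · refine Subfield.closure_le.mpr ?_
        rintro w (hw | hw)
        · exact Subfield.subset_closure (Or.inl hw)
        · rw [Set.mem_singleton_iff.mp hw]
          have h2 : y⁻¹ ∈ Subfield.closure ((C : Set Ω) ∪ {y⁻¹}) :=
            Subfield.subset_closure (Or.inr rfl)
          have := inv_mem h2
          rwa [inv_inv] at this
  have htk : Transcendental k t := fun h => htC (isAlgebraic_of_subfield_le hkC h)
  have hgen : K₁ ≤ henselization V (Subfield.closure ((C : Set Ω) ∪ {t})) :=
    hK₁F.trans (hFy.trans (henselization_mono V hH hclos))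
  ------------------------------------------------------------------
  -- ### Step 5: descent to a finite level
  ------------------------------------------------------------------
  have hCsep : ∀ c ∈ C, IsSeparable P c := fun c hc =>
    isSeparable_of_isAlgebraic_of_perfectField (isAlgebraic_of_subfield_le hkP (hCalg c hc))
  have hCh : C ≤ henselization V (K₁ ⊔ P) := hCE
  obtain ⟨S, Y, hSP, hYC, hYsep, -, hYh, hK₁le⟩ :=
    exists_finite_level_valuative_datum V hkP hPC hfg hCsep hCh (hK'F htK') hgen
  -- `t ∈ K₁·k(S₀)` for a finite `S₀ ⊆ P`
  obtain ⟨S₀, hS₀P, hS₀⟩ := exists_finset_forall_mem_closure_levels hkP (K₁ : Set Ω) {t}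
    (fun w hw => by
      rw [Finset.mem_singleton.mp hw, Subfield.closure_union, Subfield.closure_eq,
        Subfield.closure_eq, sup_comm]
      exact htK')
  have htS₀ : t ∈ K₁ ⊔ Subfield.closure ((k : Set Ω) ∪ ↑(S₀ ∪ S)) := by
    have h := hS₀ t (Finset.mem_singleton_self t)
    refine (Subfield.closure_le.mpr ?_) h
    rintro w ((hw | hw) | hw)
    · exact (le_sup_right : Subfield.closure ((k : Set Ω) ∪ ↑(S₀ ∪ S)) ≤ _)
        (Subfield.subset_closure (Or.inl hw))
    · exact (le_sup_right : Subfield.closure ((k : Set Ω) ∪ ↑(S₀ ∪ S)) ≤ _)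
        (Subfield.subset_closure (Or.inr (Finset.mem_union_left _ hw)))
    · exact (le_sup_left : K₁ ≤ _) hw
  -- monotonicity in `S`
  have hmono : Subfield.closure ((k : Set Ω) ∪ ↑S) ≤ Subfield.closure ((k : Set Ω) ∪ ↑(S₀ ∪ S)) :=
    Subfield.closure_mono (Set.union_subset_union_right _ (by
      rw [Finset.coe_union]; exact Set.subset_union_right))
  haveI : ExpChar Ω p := ExpChar.prime hp
  have hq : ringExpChar Ω = p := ringExpChar.eq Ω p
  refine ⟨S₀ ∪ S, Y, t, fun s hs => ?_, fun y hy => isSeparable_of_subfield_le hmono (hYsep y hy),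
    htS₀, htV, htk, ?_, ?_⟩
  · -- `S₀ ∪ S ⊆ P`: purely inseparable over `k`
    have hsP : s ∈ P := by
      rcases Finset.mem_union.mp hs with h | h
      · exact hS₀P h
      · exact hSP h
    obtain ⟨n, hn⟩ := (mem_perfectHull_iff' k).mp hsP
    exact ⟨n, hn⟩
  · exact hYh.trans (henselization_mono V hH (sup_le_sup_left hmono K₁))
  · refine hK₁le.trans (henselization_mono V hH (Subfield.closure_mono ?_))
    refine Set.union_subset_union_left _ (Set.union_subset_union_left _ ?_)
    exact Set.union_subset_union_right _ (by rw [Finset.coe_union]; exact Set.subset_union_right)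

end Literature.AlgebraicGeometry.Resolution

end
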